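import Literature.MathematicalPhysics.QuantumFieldTheory.Balaban1983to89.B15BasicStep

/-!
# `Balaban1983to89.B15Norm1102Multi` — [Balaban1989LargeFieldI] (1.100)/(1.102) p. 201: the normalization mechanism for
# a family of `n` renormalized components `X_1, …, X_n` with PAIRWISE-DISJOINT integration domains `Λ_1, …, Λ_n` — the
# `n`-component analogue of `B15.BasicStep.lmarginal_norm_term` / `integral_normTerm_eq`, PROVED

statement-level skeleton of published theorems with citation tags; proofs where landed; nothing here is a claim about
the Yang–Mills mass gap.

CITATION HEADER (lean-in-tree rule 2026-08-18).  T. Bałaban, *Large field renormalization. I. The basic step of the 𝐑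
operation*, Commun. Math. Phys. **122**, 175–202 (1989), doi:10.1007/BF01257412, bib `Balaban1989LargeFieldI` (cell
paper B15; PDF held `paper:balaban1989-cmp122-large-field-i`, journal page = PDF page + 174; pp. 176, 193–194, 201–202
READ AS IMAGES on the x2 renders `run/shared/lean/pub/pub-balaban/b2b-balaban-ref1/pages/1989-cmp122-large-field-I/
…-p002,p019,p020,p027,p028-x2.png`).  The paper is a manuscript under adjudication by the audit cell `pub-balaban`;
NOTHING printed in it is asserted here as a fact: this module proves, by elementary measure theory over Mathlib's
`MeasureTheory.lmarginal` (iterated integrals over a finite product of measure spaces), the MECHANISM by which the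
`n` insert quotients of one family term of (1.100) integrate to one simultaneously.  WHAT IS REPRODUCED: SKELETON rows
`B15.Eq1.102` / `B15.Obj1.100` / `B15.Eq1.100`, unit `lit-balaban-r12` gen 7 (reader/typer and fold owner of block B15,
Phase 2 in own block), HOME `run/shared/lean/pub/lit-balaban/` (`lit-balaban-r12/ROWS-B15.md`).  Tree vocabulary used
BY NAME, nothing restated: `B15.BasicStep.IndepOf` ("a function of `V⌈_{Λᶜ}`"), `indepOf_lmarginal`,
`lmarginal_mul_of_indepOf`, `lmarginal_of_indepOf`, `lmarginal_norm_term` (ONE normalized term integrates to its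
fibre-independent factor), `fibreIntegral` (`∫dV⌈_Λ` of a real density), `lmarginal_ofReal_le`, `fieldMeasure_eq_pi`;
`Setup.fieldMeasure`/`Density`/`GaugeField`/`PBond`/`HaarData`.

THE PRINTED SENTENCES (verbatim).  p. 201 [PDF 27]: *"Now we rearrange the sum above. We denote Z_k∖Z by Z_k, we write
Z explicitly as a union of components, Z = X_1 ∪ ⋯ ∪ X_n, and we separate the summation over the admissible Z_k, n,
X_1,…,X_n, from the remaining summations, which are factorized in those domains. … Denote the sequence localized in X_i
by {Ω^c_{i,j}, Z_{i,j}}, and 𝔹₀, T₀, Λ localized in X_i by 𝔹_i, T_i, Λ_i. The integrations in (1.99) are also factorized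
in those components."*;  (1.100): *"(ℝ′ρ_k)(V_k) = Σ_{Z_k}( Σ 𝕋″_k(Z_k) ){ Σ_{n≥0} Σ_{{X_1,…,X_n}} χ_k(Ω_k^{∼4})
Π_{i=1}^{n}[ (1/N_i) Σ χ_{k,Λ_i} · δ_{G_i}(V′_k)χ(Λ_i)exp[−(1/g_k²)A(ζ_i,U_{k,X_i}(V′_kV_{Λ_i}))] / ∫dV′⌈_{Λ_i}δ_{G_i}(V′)
χ(Λ_i)exp[−(1/g_k²)A(ζ_i,U_{k,X_i}(V′V_{Λ_i}))] · ∫dV_h⌈…𝕋_h(Z_{i,h})∫dV′⌈_{𝔹_i}δ_{T_i}(V′)χ′_i ] exp A″_k }"*;  (1.102):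
*"The above operation has the fundamental normalization property ∫dV_k(ℝ′ρ_k)(V_k) = ∫dV_kρ_k(V_k)."*;  p. 194 [PDF 20]:
*"We obtain a new expression, which we consider as a function of all field variables V_k, but independent of V_k⌈_Λ."*;
p. 176 [PDF 2]: *"We will prove that the densities are positive, and the inegration* [sic] *domains in the integrals above are
nonempty, hence the denominators are positive, and the operation ℝ is well defined. It satisfies the basic normalization
property ∫dV(ℝρ)(V) = ∫dVρ(V). (0.4)"*.

WHAT IS TYPED AND PROVED (0 `sorry`, no `def`, no new `Prop`; all `theorem`s kernel-checked).
* Part 1 — small API for `B15.BasicStep.IndepOf`: `indepOf_iff_forall_eq` (⇔ equal values at configurations agreeing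
  off the set — the meaning of p. 194's "independent of V_k⌈_Λ"), `indepOf_union`, `indepOf_biUnion`,
  `indepOf_lmarginal` (a fibre integral over ANY variables of a function independent of `t` is independent of `t` — the
  denominators of the OTHER components do not depend on `V⌈_{Λ_i}`, p. 194/p. 201); private one-liners `indepOf_empty`,
  `indepOf_mul`, `indepOf_div`, `indepOf_finset_prod`.
* Part 2 — THE MECHANISM (`ℝ≥0∞`, any finite product of σ-finite measure spaces): `lmarginal_prod_norm_eq` — for
  finitely many components `a ∈ A` with pairwise-disjoint domains `s a`, measurable inserts `den a` each independent of
  the other domains, a factor `N` independent of all domains, denominators `∫⌈_{s a}den a ∉ {0, ∞}`: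
  `∫⋯∫⁻_{⋃ s a} (Π_{a∈A} den_a/∫⌈_{s a}den_a)·N = N` (induction on the components: `lmarginal_union'` peels one domain,
  `lmarginal_norm_term` integrates its insert to one against the rest, which Part 1 shows independent of that domain);
  `lintegral_prod_norm_eq` — over PROBABILITY fibres the total integrals of `(Π …)·N` and `N` agree
  (`lintegral_eq_of_lmarginal_eq` + `lmarginal_of_indepOf`); `measurable_prod_norm`.
* Part 3 — over `Setup` (real densities, Bochner integrals, `fieldMeasure` = product of the normalized Haar measures):
  `integral_prodNorm_eq` — `∫dV_k (Π_{a∈A} new_a/∫dV′⌈_{Λ_a}new_a)·old = ∫dV_k old` under the printed provisos made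
  explicit (measurable, nonnegative, bounded `new a`; measurable nonnegative `old`; pairwise-disjoint `Λ_a`; `new a`
  independent of `V_k⌈_{Λ_b}`, `b ≠ a`; `old` independent of every `V_k⌈_{Λ_a}`; `∫dV′⌈_{Λ_a}new_a ≠ 0`).  For `A` a
  singleton this is b01's `integral_normTerm_eq` (one normalized term); the OBJECT-level one-component instance is
  `B15Sect1Statements.integral_rPrime1100_single`, and (1.102) for the object 𝐑′ in general stays the leaf
  `B15Sect1Statements.Normalization1102` (reduced to (1.99) + "inserts integrate to one" by
  `normalization1102_of_equiv199`); this module supplies "inserts integrate to one" for `n` components at once, in the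
  factorized form the paper states on p. 201.
NOT CLAIMED: the provisos themselves (positivity and analyticity of the effective densities, [II]); the geometry making
the `Λ_i` disjoint and the inserts `X_i`-local ((1.6)–(1.23), (1.73), conditions (i)/(ii) p. 177); anything about the
operations `𝕋″_k(Z_k)`.
-/

open scoped BigOperators ENNReal
open _root_.MeasureTheory Function Finset

namespace Literature.MathematicalPhysics.QuantumFieldTheory.Balaban1983to89.B15Norm1102Multi

open B15.BasicStep

/-! ## Part 1. Small API for `B15.BasicStep.IndepOf` ("a function of `V⌈_{sᶜ}` only") -/

section IndepOfAPI

variable {ι : Type*} [DecidableEq ι] {X : ι → Type*}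

/-- `IndepOf s f` says exactly: `f` takes equal values at any two configurations agreeing off `s` — the meaning of
p. 194 *"a new expression, which we consider as a function of all field variables V_k, but independent of V_k⌈_Λ"*.
[cite: Balaban1989LargeFieldI, p.194] -/
theorem indepOf_iff_forall_eq (s : Finset ι) (f : (∀ i, X i) → ℝ≥0∞) :
    IndepOf s f ↔ ∀ x x' : ∀ i, X i, (∀ i, i ∉ s → x i = x' i) → f x = f x' := by
  constructor
  · intro h x x' hxx'
    have hx' : x' = updateFinset x s (fun i : s => x' i) := by
      funext i
      by_cases hi : i ∈ s
      · simp [updateFinset, hi]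
      · simp [updateFinset, hi, hxx' i hi]
    rw [hx']
    exact (h x _).symm
  · intro h x y
    refine h _ _ (fun i hi => ?_)
    simp [updateFinset, hi]

/-- Nothing depends on no variables. [folklore] -/
private theorem indepOf_empty (f : (∀ i, X i) → ℝ≥0∞) : IndepOf (∅ : Finset ι) f := by
  intro x y
  simp

/-- Independence of the variables `s` and of the variables `t` gives independence of `s ∪ t` (an expression localized
away from two components is localized away from their union; p. 201 *"localized in the components"*).
[cite: Balaban1989LargeFieldI, p.201] -/
theorem indepOf_union {s t : Finset ι} {f : (∀ i, X i) → ℝ≥0∞} (hs : IndepOf s f) (ht : IndepOf t f) :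
    IndepOf (s ∪ t) f := by
  rw [indepOf_iff_forall_eq] at hs ht ⊢
  intro x x' h
  -- go from `x` to `x'` through the intermediate point `x″ = x` updated on `s` by `x'`
  have h1 : f x = f (updateFinset x s (fun i : s => x' i)) :=
    hs _ _ (fun i hi => by simp [updateFinset, hi])
  have h2 : f (updateFinset x s (fun i : s => x' i)) = f x' := by
    refine ht _ _ (fun i hit => ?_)
    by_cases his : i ∈ s
    · simp [updateFinset, his]
    · simp only [updateFinset, his, dif_neg, not_false_iff]
      exact h i (by simp [his, hit])
  exact h1.trans h2

/-- Independence of every `s a`, `a ∈ A`, gives independence of `⋃_{a∈A} s a` (p. 201: the factor outside the brackets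
of (1.100) is independent of all the localized domains `Λ_1, …, Λ_n`). [cite: Balaban1989LargeFieldI, (1.100) p.201] -/
theorem indepOf_biUnion {α : Type*} [DecidableEq α] (A : Finset α) (s : α → Finset ι)
    {f : (∀ i, X i) → ℝ≥0∞} (h : ∀ a ∈ A, IndepOf (s a) f) : IndepOf (A.biUnion s) f := by
  induction A using Finset.induction_on with
  | empty => simpa using indepOf_empty f
  | insert a A ha IH =>
    rw [Finset.biUnion_insert]
    exact indepOf_union (h a (mem_insert_self a A)) (IH (fun b hb => h b (mem_insert_of_mem hb)))

/-- Products of independent functions are independent. [folklore] -/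
private theorem indepOf_mul {s : Finset ι} {f g : (∀ i, X i) → ℝ≥0∞} (hf : IndepOf s f) (hg : IndepOf s g) :
    IndepOf s (fun V => f V * g V) := fun x y => by simp only [hf x y, hg x y]

/-- Quotients of independent functions are independent. [folklore] -/
private theorem indepOf_div {s : Finset ι} {f g : (∀ i, X i) → ℝ≥0∞} (hf : IndepOf s f) (hg : IndepOf s g) :
    IndepOf s (fun V => f V / g V) := fun x y => by simp only [hf x y, hg x y]

/-- Finite products of independent functions are independent. [folklore] -/
private theorem indepOf_finset_prod {α : Type*} {s : Finset ι} (A : Finset α) {f : α → (∀ i, X i) → ℝ≥0∞}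
    (hf : ∀ a ∈ A, IndepOf s (f a)) : IndepOf s (fun V => ∏ a ∈ A, f a V) :=
  fun x y => Finset.prod_congr rfl (fun a ha => hf a ha x y)

variable [∀ i, MeasurableSpace (X i)] {μ : ∀ i, Measure (X i)}

/-- A fibre integral over ANY set of variables of a function independent of the variables `t` is still independent of
`t` — the denominators `∫dV′⌈_{Λ_{i′}} …` of the OTHER components do not depend on `V⌈_{Λ_i}` (p. 194: *"The two
integrals above are over the disjoint regions of integrations, hence we can consider them independently"*; p. 201: *"The
integrations in (1.99) are also factorized in those components"*). [cite: Balaban1989LargeFieldI, p.194] -/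
theorem indepOf_lmarginal {s t : Finset ι} {f : (∀ i, X i) → ℝ≥0∞} (hf : IndepOf t f) :
    IndepOf t (∫⋯∫⁻_s, f ∂μ) := by
  rw [indepOf_iff_forall_eq] at hf ⊢
  intro x x' h
  simp only [lmarginal]
  refine lintegral_congr (fun z => hf _ _ (fun i hi => ?_))
  by_cases his : i ∈ s
  · simp [updateFinset, his]
  · simp [updateFinset, his, h i hi]

end IndepOfAPI

/-! ## Part 2. The `n`-component mechanism over a finite product of measure spaces (`ℝ≥0∞`-valued) -/

section Mechanism

variable {ι : Type*} [DecidableEq ι] {X : ι → Type*} [∀ i, MeasurableSpace (X i)] {μ : ∀ i, Measure (X i)}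

/-- Measurability of the `n`-component normalized product `(Π_{a∈A} den_a/∫⌈_{Λ_a}den_a)·N` of (1.100) (measurable
inserts and factor). [cite: Balaban1989LargeFieldI, (1.100) p.201] -/
theorem measurable_prod_norm [∀ i, SigmaFinite (μ i)] {α : Type*} (A : Finset α) (s : α → Finset ι)
    {den : α → (∀ i, X i) → ℝ≥0∞} {N : (∀ i, X i) → ℝ≥0∞} (hden : ∀ a ∈ A, Measurable (den a))
    (hN : Measurable N) :
    Measurable (fun V => (∏ a ∈ A, den a V / (∫⋯∫⁻_(s a), den a ∂μ) V) * N V) :=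
  (Finset.measurable_prod A (fun a ha => (hden a ha).div ((hden a ha).lmarginal μ))).mul hN

/-- **The `n`-component normalization mechanism of (1.100)/(1.102)** p. 201 [PDF 27], FIBREWISE.  The paper: *"we write
Z explicitly as a union of components, Z = X_1 ∪ ⋯ ∪ X_n … the remaining summations, which are factorized in those
domains. … The integrations in (1.99) are also factorized in those components."* and (1.100): the curly bracket carries
`Π_{i=1}^{n}[ … (insert_i)/(∫dV′⌈_{Λ_i} insert_i) · (old integrated expression)_i ]`.  MODEL (the vocabulary of
`B15.BasicStep`, Part A): finitely many components `a ∈ A` with integration domains `s a` (`Λ_i`, finite sets of variables)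
that are PAIRWISE DISJOINT, inserts `den a` measurable with every `den a` independent of the variables of the OTHER
domains `s b` (`b ≠ a`), a factor `N` (the product of the old integrated expressions and everything outside the brackets)
independent of all the `s a`, and denominators `∫⌈_{s a} den a` neither `0` nor `∞` (p. 176: *"hence the denominators are positive"*).  CONCLUSION: the fibre integral over `⋃_{a∈A} s a` of `(Π_{a∈A} den_a/∫⌈_{s a}den_a)·N` is `N` — the inserts
integrate to one simultaneously.  Proof = induction on the components: peel one domain off the disjoint union
(`lmarginal_union'`), integrate its insert to one against the rest, which is independent of that domain
(`B15.BasicStep.lmarginal_norm_term`). [cite: Balaban1989LargeFieldI, (1.100)/(1.102) p.201] -/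
theorem lmarginal_prod_norm_eq [∀ i, SigmaFinite (μ i)] {α : Type*} [DecidableEq α] (A : Finset α)
    (s : α → Finset ι) {den : α → (∀ i, X i) → ℝ≥0∞} {N : (∀ i, X i) → ℝ≥0∞}
    (hden : ∀ a ∈ A, Measurable (den a)) (hN : Measurable N)
    (hdisj : ∀ a ∈ A, ∀ b ∈ A, a ≠ b → Disjoint (s a) (s b))
    (hcross : ∀ a ∈ A, ∀ b ∈ A, a ≠ b → IndepOf (s b) (den a))
    (hNind : ∀ a ∈ A, IndepOf (s a) N)
    (h0 : ∀ a ∈ A, ∀ x, (∫⋯∫⁻_(s a), den a ∂μ) x ≠ 0) (htop : ∀ a ∈ A, ∀ x, (∫⋯∫⁻_(s a), den a ∂μ) x ≠ ∞) :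
    ∫⋯∫⁻_(A.biUnion s), (fun V => (∏ a ∈ A, den a V / (∫⋯∫⁻_(s a), den a ∂μ) V) * N V) ∂μ = N := by
  induction A using Finset.induction_on with
  | empty =>
    simp only [Finset.biUnion_empty, Finset.prod_empty, one_mul, lmarginal_empty]
  | insert a A ha IH =>
    -- hypotheses for the smaller family
    have hden' : ∀ b ∈ A, Measurable (den b) := fun b hb => hden b (mem_insert_of_mem hb)
    have hdisj' : ∀ b ∈ A, ∀ c ∈ A, b ≠ c → Disjoint (s b) (s c) :=
      fun b hb c hc => hdisj b (mem_insert_of_mem hb) c (mem_insert_of_mem hc)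
    have hcross' : ∀ b ∈ A, ∀ c ∈ A, b ≠ c → IndepOf (s c) (den b) :=
      fun b hb c hc => hcross b (mem_insert_of_mem hb) c (mem_insert_of_mem hc)
    have hNind' : ∀ b ∈ A, IndepOf (s b) N := fun b hb => hNind b (mem_insert_of_mem hb)
    have h0' : ∀ b ∈ A, ∀ x, (∫⋯∫⁻_(s b), den b ∂μ) x ≠ 0 := fun b hb => h0 b (mem_insert_of_mem hb)
    have htop' : ∀ b ∈ A, ∀ x, (∫⋯∫⁻_(s b), den b ∂μ) x ≠ ∞ := fun b hb => htop b (mem_insert_of_mem hb)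
    -- the rest `G = (Π_{b∈A} den_b/∫⌈den_b)·N` is independent of the variables `s a`
    set G : (∀ i, X i) → ℝ≥0∞ := fun V => (∏ b ∈ A, den b V / (∫⋯∫⁻_(s b), den b ∂μ) V) * N V with hG
    have hne : ∀ b ∈ A, b ≠ a := fun b hb hba => ha (hba ▸ hb)
    have hGind : IndepOf (s a) G := by
      refine indepOf_mul (indepOf_finset_prod A (fun b hb => ?_)) (hNind a (mem_insert_self a A))
      have hb' : IndepOf (s a) (den b) :=
        hcross b (mem_insert_of_mem hb) a (mem_insert_self a A) (hne b hb)
      exact indepOf_div hb' (indepOf_lmarginal hb')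
    have hGm : Measurable G := measurable_prod_norm A s hden' hN
    -- the full integrand is `den_a · (G / ∫⌈den_a)`
    have hF : (fun V => (∏ b ∈ insert a A, den b V / (∫⋯∫⁻_(s b), den b ∂μ) V) * N V)
        = fun V => den a V * (G V / (∫⋯∫⁻_(s a), den a ∂μ) V) := by
      funext V
      rw [Finset.prod_insert ha, hG]
      simp only [div_eq_mul_inv]
      ring
    have hFm : Measurable (fun V => (∏ b ∈ insert a A, den b V / (∫⋯∫⁻_(s b), den b ∂μ) V) * N V) :=
      measurable_prod_norm (insert a A) s hden hN
    -- peel the domain `s a` off the disjoint union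
    have hdj : Disjoint (s a) (A.biUnion s) := by
      rw [Finset.disjoint_biUnion_right]
      exact fun b hb => hdisj a (mem_insert_self a A) b (mem_insert_of_mem hb) (hne b hb).symm
    rw [Finset.biUnion_insert, lmarginal_union' μ _ hFm hdj, hF,
      lmarginal_norm_term (s a) hGind (hden a (mem_insert_self a A)) (h0 a (mem_insert_self a A))
        (htop a (mem_insert_self a A))]
    exact IH hden' hdisj' hcross' hNind' h0' htop'

/-- **The same over the whole space of fields** (PROBABILITY fibres — the normalized Haar measures of p. 176): the
`n`-component normalized product has the same total integral as `N`.  This is the kernel of (1.102) *"∫dV_k(ℝ′ρ_k)(V_k) =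
∫dV_kρ_k(V_k)"* for one term of the family sum of (1.100): after the inserts have integrated to one, what is left is the
corresponding term of (1.99), whose integral is that of `ρ_k` by the equivalence (1.99) (`B15Sect1Statements.Equiv199`,
`normalization1102_of_equiv199`). [cite: Balaban1989LargeFieldI, (1.102) p.201] -/
theorem lintegral_prod_norm_eq [Fintype ι] [∀ i, IsProbabilityMeasure (μ i)] {α : Type*} [DecidableEq α]
    (A : Finset α) (s : α → Finset ι) {den : α → (∀ i, X i) → ℝ≥0∞} {N : (∀ i, X i) → ℝ≥0∞}
    (hden : ∀ a ∈ A, Measurable (den a)) (hN : Measurable N)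
    (hdisj : ∀ a ∈ A, ∀ b ∈ A, a ≠ b → Disjoint (s a) (s b))
    (hcross : ∀ a ∈ A, ∀ b ∈ A, a ≠ b → IndepOf (s b) (den a))
    (hNind : ∀ a ∈ A, IndepOf (s a) N)
    (h0 : ∀ a ∈ A, ∀ x, (∫⋯∫⁻_(s a), den a ∂μ) x ≠ 0) (htop : ∀ a ∈ A, ∀ x, (∫⋯∫⁻_(s a), den a ∂μ) x ≠ ∞) :
    ∫⁻ V, (∏ a ∈ A, den a V / (∫⋯∫⁻_(s a), den a ∂μ) V) * N V ∂Measure.pi μ = ∫⁻ V, N V ∂Measure.pi μ := by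
  refine lintegral_eq_of_lmarginal_eq (A.biUnion s) (measurable_prod_norm A s hden hN) hN ?_
  rw [lmarginal_prod_norm_eq A s hden hN hdisj hcross hNind h0 htop,
    lmarginal_of_indepOf (A.biUnion s) (indepOf_biUnion A s hNind)]

end Mechanism

/-! ## Part 3. The same over the cell's `Setup` vocabulary (real densities of the gauge field `V_k`, `Setup.fieldMeasure`,
`B15.BasicStep.fibreIntegral` = `∫dV⌈_Λ`): the `n`-component analogue of `B15.BasicStep.integral_normTerm_eq` -/

section SetupBridge

variable {P : Params} {j : ℕ} {G : Type*} [GaugeGroup G] [MeasurableSpace G] [HaarData G] [DecidableEq (PBond P j)]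

/-- **(1.102) for a family of `n` renormalized components, PROVED in the concrete model.**  For finitely many components
`a ∈ A` with integration domains `Λ_a` (`lam a`, finite sets of positive bonds of `T^{(k)}`) and inserts `new a` (the
printed `δ_{G_i}(V′_k)χ(Λ_i)exp[−g_k⁻²A(ζ_i, U_{k,X_i}(V′_kV_{Λ_i}))]` of (1.100), as densities in `V_k`; cf.
`B15Sect1Statements.Insert1100.num`) and an old expression `old` (the product of the old integrated expressions
`∫dV_h⌈…𝕋_h(Z_{i,h})∫dV′⌈_{𝔹_i}δ_{T_i}(V′)χ′_i[…]` with `χ_k(Ω_k^{∼4})`, the `χ_{k,Λ_i}` and `exp A″_k` after the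
`Λ_i`-integrations), under the printed provisos made explicit — every `new a` and `old` measurable, nonnegative and bounded;
the domains PAIRWISE DISJOINT (*"Z = X_1 ∪ ⋯ ∪ X_n"* a union of distinct components, `Λ_i ⊂ X_i`); the insert of
component `a` independent of the variables `V_k⌈_{Λ_b}` of every other component (*"localized in X_i"*, p. 201); `old`
independent of every `V_k⌈_{Λ_a}` (p. 194: *"a new expression … independent of V_k⌈_Λ"*; (1.75): `χ_{k,Λ}` restricts
`V_k⌈_{Z∩Λᶜ}` only); and nowhere-vanishing denominators `∫dV′⌈_{Λ_a} new a` (p. 176: *"hence the denominators are positive"*) — the density `(Π_{a∈A} new_a/∫dV′⌈_{Λ_a}new_a)·old` has the same integral over `dV_k` as `old`: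
the `n` inserts integrate to one SIMULTANEOUSLY.  For `A` a singleton this is `B15.BasicStep.integral_normTerm_eq` (up to
the placement of the old factor); the general case is the factorization sentence of p. 201 (*"The integrations in (1.99)
are also factorized in those components"*) made a theorem. [cite: Balaban1989LargeFieldI, (1.102) p.201] -/
theorem integral_prodNorm_eq {α : Type*} [DecidableEq α] (A : Finset α) (lam : α → Finset (PBond P j))
    {new : α → Density P j G} {old : Density P j G}
    (hnew_m : ∀ a ∈ A, Measurable (new a)) (hold_m : Measurable old)
    (hnew0 : ∀ a ∈ A, ∀ V, 0 ≤ new a V) (hold0 : ∀ V, 0 ≤ old V)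
    {C : ℝ} (hnewC : ∀ a ∈ A, ∀ V, new a V ≤ C)
    (hdisj : ∀ a ∈ A, ∀ b ∈ A, a ≠ b → Disjoint (lam a) (lam b))
    (hcross : ∀ a ∈ A, ∀ b ∈ A, a ≠ b → ∀ (V : GaugeField P j G) (y : ↥(lam b) → G),
      new a (updateFinset V (lam b) y) = new a V)
    (hold_ind : ∀ a ∈ A, ∀ (V : GaugeField P j G) (y : ↥(lam a) → G), old (updateFinset V (lam a) y) = old V)
    (hden : ∀ a ∈ A, ∀ V, fibreIntegral (lam a) (new a) V ≠ 0) :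
    ∫ V, (∏ a ∈ A, new a V / fibreIntegral (lam a) (new a) V) * old V ∂(fieldMeasure P j G)
      = ∫ V, old V ∂(fieldMeasure P j G) := by
  set μH : PBond P j → Measure G := fun _ => (HaarData.haar : Measure G) with hμH
  have hden_m : ∀ a ∈ A, Measurable (fun U : GaugeField P j G => ENNReal.ofReal (new a U)) :=
    fun a ha => ofReal_comp_measurable (hnew_m a ha)
  have hN_m : Measurable (fun U : GaugeField P j G => ENNReal.ofReal (old U)) := ofReal_comp_measurable hold_m
  have hD_top : ∀ a ∈ A, ∀ V, (∫⋯∫⁻_(lam a), (fun U => ENNReal.ofReal (new a U)) ∂μH) V ≠ ∞ := fun a ha V =>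
    ne_top_of_le_ne_top ENNReal.ofReal_ne_top (lmarginal_ofReal_le (lam a) (hnewC a ha) V)
  have hD_0 : ∀ a ∈ A, ∀ V, (∫⋯∫⁻_(lam a), (fun U => ENNReal.ofReal (new a U)) ∂μH) V ≠ 0 := by
    intro a ha V h
    apply hden a ha V
    simp only [fibreIntegral]
    rw [← hμH, h, ENNReal.toReal_zero]
  have hcross' : ∀ a ∈ A, ∀ b ∈ A, a ≠ b → IndepOf (lam b) (fun U : GaugeField P j G => ENNReal.ofReal (new a U)) := by
    intro a ha b hb hab x y
    show ENNReal.ofReal (new a (updateFinset x (lam b) y)) = ENNReal.ofReal (new a x)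
    rw [hcross a ha b hb hab x y]
  have hold' : ∀ a ∈ A, IndepOf (lam a) (fun U : GaugeField P j G => ENNReal.ofReal (old U)) := by
    intro a ha x y
    show ENNReal.ofReal (old (updateFinset x (lam a) y)) = ENNReal.ofReal (old x)
    rw [hold_ind a ha x y]
  -- pointwise: the real integrand is `toReal` of the finite `ℝ≥0∞` normalized product
  have hpt : ∀ V, (∏ a ∈ A, new a V / fibreIntegral (lam a) (new a) V) * old V
      = ((∏ a ∈ A, ENNReal.ofReal (new a V) / (∫⋯∫⁻_(lam a), (fun U => ENNReal.ofReal (new a U)) ∂μH) V)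
          * ENNReal.ofReal (old V)).toReal := by
    intro V
    rw [ENNReal.toReal_mul, ENNReal.toReal_prod, ENNReal.toReal_ofReal (hold0 V)]
    congr 1
    refine Finset.prod_congr rfl (fun a ha => ?_)
    rw [ENNReal.toReal_div, ENNReal.toReal_ofReal (hnew0 a ha V)]
    rfl
  have hE_top : ∀ V, (∏ a ∈ A, ENNReal.ofReal (new a V) /
      (∫⋯∫⁻_(lam a), (fun U => ENNReal.ofReal (new a U)) ∂μH) V) * ENNReal.ofReal (old V) ≠ ∞ := fun V =>
    ENNReal.mul_ne_top
      (ENNReal.prod_ne_top (fun a ha => (ENNReal.div_lt_top ENNReal.ofReal_ne_top (hD_0 a ha V)).ne))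
      ENNReal.ofReal_ne_top
  have hE_m : Measurable (fun V => (∏ a ∈ A, ENNReal.ofReal (new a V) /
      (∫⋯∫⁻_(lam a), (fun U => ENNReal.ofReal (new a U)) ∂μH) V) * ENNReal.ofReal (old V)) :=
    measurable_prod_norm (den := fun a (U : GaugeField P j G) => ENNReal.ofReal (new a U)) A lam hden_m hN_m
  calc ∫ V, (∏ a ∈ A, new a V / fibreIntegral (lam a) (new a) V) * old V ∂(fieldMeasure P j G)
      = ∫ V, ((∏ a ∈ A, ENNReal.ofReal (new a V) /
          (∫⋯∫⁻_(lam a), (fun U => ENNReal.ofReal (new a U)) ∂μH) V) * ENNReal.ofReal (old V)).toReal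
          ∂(Measure.pi μH) := by
        rw [fieldMeasure_eq_pi]
        exact integral_congr_ae (Filter.Eventually.of_forall hpt)
    _ = (∫⁻ V, (∏ a ∈ A, ENNReal.ofReal (new a V) /
          (∫⋯∫⁻_(lam a), (fun U => ENNReal.ofReal (new a U)) ∂μH) V) * ENNReal.ofReal (old V)
          ∂(Measure.pi μH)).toReal :=
        integral_toReal hE_m.aemeasurable (Filter.Eventually.of_forall (fun V => (hE_top V).lt_top))
    _ = (∫⁻ V, ENNReal.ofReal (old V) ∂(Measure.pi μH)).toReal := by
        congr 1
        convert lintegral_prod_norm_eq (den := fun a (U : GaugeField P j G) => ENNReal.ofReal (new a U)) A lam hden_m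
          hN_m hdisj hcross' hold' hD_0 hD_top using 9
    _ = ∫ V, (ENNReal.ofReal (old V)).toReal ∂(Measure.pi μH) :=
        (integral_toReal hN_m.aemeasurable (Filter.Eventually.of_forall (fun V => ENNReal.ofReal_lt_top))).symm
    _ = ∫ V, old V ∂(fieldMeasure P j G) := by
        rw [fieldMeasure_eq_pi]
        exact integral_congr_ae (Filter.Eventually.of_forall (fun V => ENNReal.toReal_ofReal (hold0 V)))

end SetupBridge

end Literature.MathematicalPhysics.QuantumFieldTheory.Balaban1983to89.B15Norm1102Multi
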